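import Summits.BirchSwinnertonDyer.Rank1Residual.X12.CMTwoTorsion
import HarnessLib

/-!
# `E(ℚ)[2] ≃ ℤ/2ℤ` EXACTLY for every elliptic curve over `ℚ` with CM field `ℚ(√−7)`
# (Burungale–Castella–Skinner–Tian 2022, Remark D, verbatim) — the full `2`-torsion is never rational

HONEST FRAMING (cell `b2b-bsdres`, run/shared/lean/b2b/bsd-rank1-residual/, verbatim in every
file): the goal of the cell is to DELETE the COMBINATION-SHAPED residual classes of the
Birch–Swinnerton-Dyer formula for ALL analytic-rank `≤ 1` elliptic curves over `ℚ` — "full BSD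
formula for every rank `≤ 1` curve in class `C`" assembled STRICTLY from published theorems — so
that the rank-`≤ 1` remainder becomes exactly the CONSTRUCTION-SHAPED classes, which are TYPED
(missing-input `Prop`s), NOT attempted. This is not "finishing BSD". Literature typer seat
`b2b-bsdres-lit-bst` (Burungale–Skinner–Tian / Burungale–Castella–Skinner–Tian; "the `p = 2, 3`
and CM corner statements identified precisely"), gen 5, second file. THEOREMS ONLY (no definition,
no named fact, no axiom, no table, no certificate). Nothing is booked; no label and no census
number moves; class X12 REMAINS CONSTRUCTION-SHAPED.

## What is proved

The companion file `X12/CMTwoTorsion.lean` (p245325) proves EXISTENCE of a rational point of order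
`2` on every `E/ℚ` with `j(E) ∈ {−3375, 16581375}` (CM field `K = ℚ(√−7)`), which is what makes
hypothesis (i) of BCST Corollary B fail at `p = 2`. Remark D (Ann. Math. Québec 46 (2022) p. 327)
says more, verbatim: "`E(ℚ)[2] ≃ ℤ/2ℤ` for all elliptic curves `E/ℚ` with CM by `ℚ(√−7)`" — i.e.
the point of order `2` is UNIQUE, so in particular the full `2`-torsion is never rational and
Smith's hypothesis "`E(ℚ)[2] ≃ (ℤ/2ℤ)²`" (Rem. D, first sentence) is never met on this family; this
is the precise sense in which Theorem A at `p = 2` "falls short" of the Goldfeld application. This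
file proves the uniqueness:

* `eq_negY_of_two_nsmul_eq_zero`, `bCubic_root_of_eq_negY`, `cCubic_root_of_bCubic_root'`,
  `yCubic_root_of_cCubic_root` (any field): a rational point `P ≠ O` with `2P = O` is `(x, y)` with
  `2y + a₁x + a₃ = 0`, hence `4x³ + b₂x² + 2b₄x + b₆ = 0`, hence `X = 36x + 3b₂` is a root of
  `X³ − 27c₄X − 54c₆`, hence — if `j = j₀ ∉ {0, 1728}` and `a(j₀ − 1728) = j₀` — `Y = (c₄/c₆)·X`
  is a root of `Y³ − 27aY − 54a` (the converse of the chain in `CMTwoTorsion.lean`).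
* `yCubic_neg_3375_root_unique`: over `ℚ`, `Y³ − (125/7)Y − 250/7 = (Y − 5)(Y² + 5Y + 50/7)` and
  `Y² + 5Y + 50/7 = (Y + 5/2)² + 25/28 > 0`, so `Y = 5`; `yCubic_16581375_root_unique`: over `ℚ`,
  `Y³ − 27aY − 54a = (Y + 170/57)(Y² − (170/57)Y − 7225/399)` (`a = 614125/614061`) and a rational
  root of the second factor would give `((798Y − 1190)/1360)² = 7`, contradicting
  `¬ IsSquare (7 : ℚ)` (`Nat.Prime.not_isSquare`); so `Y = −170/57`. (Over `ℝ` the second factor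
  HAS roots — the other two `2`-torsion points of the `j = 255³` curves live over `ℚ(√7)` — so this
  half is genuinely arithmetic.)
* `twoTorsion_unique_of_j_eq_neg_3375`, `twoTorsion_unique_of_j_eq_16581375`,
  `twoTorsion_unique_of_cmFieldDiscrOfJ_eq_neg_seven`: any two rational points of order `2`
  coincide; with existence (companion file): `existsUnique_twoTorsion_of_cmFieldDiscrOfJ_eq_neg_seven`
  (`∃! P ≠ O, 2P = O` — i.e. `E(ℚ)[2] ≃ ℤ/2ℤ`), and `not_fullTwoTorsion_of_cmFieldDiscrOfJ_eq_neg_seven`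
  (there are no two DISTINCT rational points of order `2`: `E(ℚ)[2] ≄ (ℤ/2ℤ)²`).

## References
* A. Burungale, F. Castella, C. Skinner, Y. Tian, Ann. Math. Québec 46 (2022) 325–346, Rem. D
  (p. 327). [BurungaleCastellaSkinnerTian2022]
* J. H. Silverman, *The Arithmetic of Elliptic Curves*, 2nd ed., GTM 106 (2009), III §1, III.2.3.
  [SilvermanAEC2009]
-/

set_option autoImplicit false

open WeierstrassCurve Literature.NumberTheory.EllipticCurves
  Literature.NumberTheory.EllipticCurves.Rank1Residual
  Literature.NumberTheory.EllipticCurves.BurungaleCastellaSkinnerTian2022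

namespace Summit.BirchSwinnertonDyer.Rank1Residual.X12

/-! ### The converse chain, over any field -/

section AnyField

variable {F : Type*} [Field F] (W : WeierstrassCurve F)

/-- A rational affine point `P = (x, y)` with `2P = O` satisfies `P = −P`, i.e.
`y = −y − a₁x − a₃`. [cite: SilvermanAEC2009, III.2.3] -/
theorem eq_negY_of_two_nsmul_eq_zero [DecidableEq F] {x y : F} {h : W.toAffine.Nonsingular x y}
    (h2 : 2 • (Affine.Point.some x y h) = 0) : y = W.toAffine.negY x y := by
  rw [two_nsmul, add_eq_zero_iff_eq_neg, Affine.Point.neg_some, Affine.Point.some.injEq] at h2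
  exact h2.2

/-- On the Weierstrass equation, `2y + a₁x + a₃ = 0` forces `4x³ + b₂x² + 2b₄x + b₆ = 0`
(`4·(x³ + a₂x² + a₄x + a₆) + (a₁x + a₃)² = (2y + a₁x + a₃)²`). [cite: SilvermanAEC2009, III §1] -/
theorem bCubic_root_of_eq_negY {x y : F} (heq : W.toAffine.Equation x y)
    (hy : y = W.toAffine.negY x y) :
    4 * x ^ 3 + W.b₂ * x ^ 2 + 2 * W.b₄ * x + W.b₆ = 0 := by
  rw [Affine.equation_iff] at heq
  have hy' : 2 * y + W.a₁ * x + W.a₃ = 0 := by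
    rw [Affine.negY] at hy
    linear_combination hy
  simp only [b₂, b₄, b₆]
  linear_combination (-4 : F) * heq + (2 * y + W.a₁ * x + W.a₃) * hy'

/-- `X = 36x + 3b₂` turns a root of `4x³ + b₂x² + 2b₄x + b₆` into a root of `X³ − 27c₄X − 54c₆`
(`11664·(4x³ + …) = X³ − 27c₄X − 54c₆`). [cite: SilvermanAEC2009, III §1] -/
theorem cCubic_root_of_bCubic_root' (x : F)
    (hb : 4 * x ^ 3 + W.b₂ * x ^ 2 + 2 * W.b₄ * x + W.b₆ = 0) :
    (36 * x + 3 * W.b₂) ^ 3 - 27 * W.c₄ * (36 * x + 3 * W.b₂) - 54 * W.c₆ = 0 := by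
  simp only [c₄, c₆]
  linear_combination (11664 : F) * hb

/-- If `j(E) = j₀ ∉ {0, 1728}` and `a(j₀ − 1728) = j₀` then `c₄ ≠ 0`, `c₆ ≠ 0` and `a·c₆² = c₄³`.
[cite: SilvermanAEC2009, III §1] -/
theorem c₄_ne_zero_and_c₆_ne_zero_and_key [W.IsElliptic] {j₀ a : F} (hj : W.j = j₀) (h0 : j₀ ≠ 0)
    (h1728 : j₀ ≠ 1728) (ha : a * (j₀ - 1728) = j₀) :
    W.c₄ ≠ 0 ∧ W.c₆ ≠ 0 ∧ a * W.c₆ ^ 2 = W.c₄ ^ 3 := by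
  have hΔ : W.Δ ≠ 0 := W.coe_Δ' ▸ W.Δ'.ne_zero
  have hjΔ : j₀ * W.Δ = W.c₄ ^ 3 := hj ▸ j_mul_Δ_eq W
  have hrel : 1728 * W.Δ = W.c₄ ^ 3 - W.c₆ ^ 2 := W.c_relation
  refine ⟨fun h ↦ h0 (by rw [← hj]; exact W.j_eq_zero h), fun h ↦ h1728 ?_, ?_⟩
  · have : (j₀ - 1728) * W.Δ = 0 := by linear_combination hjΔ - hrel + W.c₆ * h
    rcases mul_eq_zero.mp this with h' | h'
    · exact sub_eq_zero.mp h'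
    · exact absurd h' hΔ
  · linear_combination W.Δ * ha - (a - 1) * hjΔ + a * hrel

/-- **Converse of the `j`-parametrisation.** If `j(E) = j₀ ∉ {0, 1728}`, `a(j₀ − 1728) = j₀` and
`X` is a root of `X³ − 27c₄X − 54c₆`, then `Y = (c₄/c₆)·X` is a root of `Y³ − 27aY − 54a`
(`c₄³·(X³ − 27c₄X − 54c₆) = c₆³·(Y³ − 27aY − 54a)` when `c₄X = c₆Y`, `ac₆² = c₄³`).
[cite: SilvermanAEC2009, III §1] -/
theorem yCubic_root_of_cCubic_root [W.IsElliptic] {j₀ a : F} (hj : W.j = j₀) (h0 : j₀ ≠ 0)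
    (h1728 : j₀ ≠ 1728) (ha : a * (j₀ - 1728) = j₀) (X : F)
    (hX : X ^ 3 - 27 * W.c₄ * X - 54 * W.c₆ = 0) :
    (W.c₄ / W.c₆ * X) ^ 3 - 27 * a * (W.c₄ / W.c₆ * X) - 54 * a = 0 := by
  obtain ⟨hc4, hc6, key⟩ := c₄_ne_zero_and_c₆_ne_zero_and_key W hj h0 h1728 ha
  set Y := W.c₄ / W.c₆ * X with hYdef
  have hXc : W.c₄ * X = W.c₆ * Y := by
    rw [hYdef]; field_simp
  have h3 : W.c₆ ^ 3 * (Y ^ 3 - 27 * a * Y - 54 * a) = 0 := by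
    linear_combination W.c₄ ^ 3 * hX - (27 * W.c₆ * Y + 54 * W.c₆) * key -
      ((W.c₄ * X) ^ 2 + W.c₄ * X * (W.c₆ * Y) + (W.c₆ * Y) ^ 2 - 27 * W.c₄ ^ 3) * hXc
  rcases mul_eq_zero.mp h3 with h' | h'
  · exact absurd h' (pow_ne_zero 3 hc6)
  · exact h'

/-- The whole converse chain: a rational point `P = (x, y) ≠ O` with `2P = O` on a curve with
`j = j₀ ∉ {0, 1728}`, `a(j₀ − 1728) = j₀`, yields the root `Y = (c₄/c₆)(36x + 3b₂)` of
`Y³ − 27aY − 54a`, and `y = −(a₁x + a₃)/2`. [cite: SilvermanAEC2009, III §1 and III.2.3] -/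
theorem yCubic_root_of_two_nsmul_eq_zero [DecidableEq F] [CharZero F] [W.IsElliptic] {j₀ a : F}
    (hj : W.j = j₀) (h0 : j₀ ≠ 0) (h1728 : j₀ ≠ 1728) (ha : a * (j₀ - 1728) = j₀) {x y : F}
    {h : W.toAffine.Nonsingular x y} (h2 : 2 • (Affine.Point.some x y h) = 0) :
    (W.c₄ / W.c₆ * (36 * x + 3 * W.b₂)) ^ 3 - 27 * a * (W.c₄ / W.c₆ * (36 * x + 3 * W.b₂)) -
        54 * a = 0 ∧ y = -(W.a₁ * x + W.a₃) / 2 := by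
  have hy := eq_negY_of_two_nsmul_eq_zero W h2
  refine ⟨yCubic_root_of_cCubic_root W hj h0 h1728 ha _
    (cCubic_root_of_bCubic_root' W x (bCubic_root_of_eq_negY W h.1 hy)), ?_⟩
  rw [Affine.negY] at hy
  have h2' : (2 : F) ≠ 0 := two_ne_zero
  field_simp
  linear_combination hy

/-- Two rational points of order `2` with the same `Y`-parameter coincide: if
`(c₄/c₆)(36x₁ + 3b₂) = (c₄/c₆)(36x₂ + 3b₂)` (with `c₄, c₆ ≠ 0`) then `x₁ = x₂`, and the
`y`-coordinates `−(a₁xᵢ + a₃)/2` agree. -/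
theorem some_eq_some_of_yParam_eq [DecidableEq F] [CharZero F] {x₁ y₁ x₂ y₂ : F}
    {h₁ : W.toAffine.Nonsingular x₁ y₁} {h₂ : W.toAffine.Nonsingular x₂ y₂}
    (hc4 : W.c₄ ≠ 0) (hc6 : W.c₆ ≠ 0)
    (hY : W.c₄ / W.c₆ * (36 * x₁ + 3 * W.b₂) = W.c₄ / W.c₆ * (36 * x₂ + 3 * W.b₂))
    (hy₁ : y₁ = -(W.a₁ * x₁ + W.a₃) / 2) (hy₂ : y₂ = -(W.a₁ * x₂ + W.a₃) / 2) :
    Affine.Point.some x₁ y₁ h₁ = Affine.Point.some x₂ y₂ h₂ := by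
  have hq : W.c₄ / W.c₆ ≠ 0 := div_ne_zero hc4 hc6
  have hx : x₁ = x₂ := by
    have h36 : (36 : F) * x₁ + 3 * W.b₂ = 36 * x₂ + 3 * W.b₂ := mul_left_cancel₀ hq hY
    have h36' : (36 : F) ≠ 0 := by norm_num
    exact mul_left_cancel₀ h36' (add_right_cancel h36)
  subst hx
  have hy : y₁ = y₂ := by rw [hy₁, hy₂]
  subst hy
  rfl

end AnyField

/-! ### Over `ℚ`: the two `ℚ(√−7)` cubics have exactly one rational root -/

section OverRat

/-- `j = −3375`: `Y³ − (125/7)Y − 250/7 = (Y − 5)·((Y + 5/2)² + 25/28)`, so `5` is the ONLY rational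
(indeed the only real) root (`a = 125/189`). -/
theorem yCubic_neg_3375_root_unique (Y : ℚ)
    (hY : Y ^ 3 - 27 * (125 / 189) * Y - 54 * (125 / 189) = 0) : Y = 5 := by
  have hfac : (Y - 5) * ((Y + 5 / 2) ^ 2 + 25 / 28) = 0 := by linear_combination hY
  rcases mul_eq_zero.mp hfac with h | h
  · linarith
  · nlinarith [sq_nonneg (Y + 5 / 2)]

/-- `7` is not the square of a rational number. -/
theorem not_isSquare_seven_rat : ¬ IsSquare (7 : ℚ) := by
  rw [show (7 : ℚ) = ((7 : ℕ) : ℚ) by norm_num, Rat.isSquare_natCast_iff]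
  exact (by norm_num : Nat.Prime 7).not_isSquare

/-- `j = 16581375`: `Y³ − 27aY − 54a = (Y + 170/57)·(Y² − (170/57)Y − 7225/399)`
(`a = 614125/614061`), and a rational root of the quadratic factor would make
`((798Y − 1190)/1360)² = 7`; so `−170/57` is the ONLY rational root (the other two roots generate
`ℚ(√7)`). -/
theorem yCubic_16581375_root_unique (Y : ℚ)
    (hY : Y ^ 3 - 27 * (614125 / 614061) * Y - 54 * (614125 / 614061) = 0) : Y = -170 / 57 := by
  have hfac : (Y + 170 / 57) * (Y ^ 2 - 170 / 57 * Y - 7225 / 399) = 0 := by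
    linear_combination hY
  rcases mul_eq_zero.mp hfac with h | h
  · linarith
  · exfalso
    apply not_isSquare_seven_rat
    refine ⟨(798 * Y - 1190) / 1360, ?_⟩
    linear_combination (-(159201 : ℚ) / 462400) * h

variable (W : WeierstrassCurve ℚ) [W.IsElliptic]

/-- **Uniqueness of the rational `2`-torsion point, `j = −3375`.** Any two rational points of order
`2` on an elliptic curve over `ℚ` with `j = −3375` coincide.
[cite: BurungaleCastellaSkinnerTian2022, Rem. D (p. 327)] [cite: SilvermanAEC2009, III §1] -/
theorem twoTorsion_unique_of_j_eq_neg_3375 (hj : W.j = -3375) (P Q : W.toAffine.Point)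
    (hP : P ≠ 0) (hP2 : 2 • P = 0) (hQ : Q ≠ 0) (hQ2 : 2 • Q = 0) : P = Q := by
  have ha : (125 / 189 : ℚ) * (-3375 - 1728) = -3375 := by norm_num
  have h0 : (-3375 : ℚ) ≠ 0 := by norm_num
  have h1728 : (-3375 : ℚ) ≠ 1728 := by norm_num
  obtain ⟨hc4, hc6, -⟩ := c₄_ne_zero_and_c₆_ne_zero_and_key W hj h0 h1728 ha
  rcases P with _ | ⟨x₁, y₁, h₁⟩
  · exact absurd rfl hP
  rcases Q with _ | ⟨x₂, y₂, h₂⟩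
  · exact absurd rfl hQ
  obtain ⟨hY₁, hy₁⟩ := yCubic_root_of_two_nsmul_eq_zero W hj h0 h1728 ha hP2
  obtain ⟨hY₂, hy₂⟩ := yCubic_root_of_two_nsmul_eq_zero W hj h0 h1728 ha hQ2
  have e₁ := yCubic_neg_3375_root_unique _ hY₁
  have e₂ := yCubic_neg_3375_root_unique _ hY₂
  exact some_eq_some_of_yParam_eq W hc4 hc6 (e₁.trans e₂.symm) hy₁ hy₂

/-- **Uniqueness of the rational `2`-torsion point, `j = 16581375`.** Any two rational points of
order `2` on an elliptic curve over `ℚ` with `j = 16581375` coincide (uses `¬ IsSquare (7 : ℚ)`).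
[cite: BurungaleCastellaSkinnerTian2022, Rem. D (p. 327)] [cite: SilvermanAEC2009, III §1] -/
theorem twoTorsion_unique_of_j_eq_16581375 (hj : W.j = 16581375) (P Q : W.toAffine.Point)
    (hP : P ≠ 0) (hP2 : 2 • P = 0) (hQ : Q ≠ 0) (hQ2 : 2 • Q = 0) : P = Q := by
  have ha : (614125 / 614061 : ℚ) * (16581375 - 1728) = 16581375 := by norm_num
  have h0 : (16581375 : ℚ) ≠ 0 := by norm_num
  have h1728 : (16581375 : ℚ) ≠ 1728 := by norm_num
  obtain ⟨hc4, hc6, -⟩ := c₄_ne_zero_and_c₆_ne_zero_and_key W hj h0 h1728 ha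
  rcases P with _ | ⟨x₁, y₁, h₁⟩
  · exact absurd rfl hP
  rcases Q with _ | ⟨x₂, y₂, h₂⟩
  · exact absurd rfl hQ
  obtain ⟨hY₁, hy₁⟩ := yCubic_root_of_two_nsmul_eq_zero W hj h0 h1728 ha hP2
  obtain ⟨hY₂, hy₂⟩ := yCubic_root_of_two_nsmul_eq_zero W hj h0 h1728 ha hQ2
  have e₁ := yCubic_16581375_root_unique _ hY₁
  have e₂ := yCubic_16581375_root_unique _ hY₂
  exact some_eq_some_of_yParam_eq W hc4 hc6 (e₁.trans e₂.symm) hy₁ hy₂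

/-- **BCST 2022, Remark D, uniqueness half:** on an elliptic curve `E/ℚ` with CM field `ℚ(√−7)`
(`d_K = −7`, `j ∈ {−3375, 16581375}`) any two rational points of order `2` coincide.
[cite: BurungaleCastellaSkinnerTian2022, Rem. D (p. 327)] -/
theorem twoTorsion_unique_of_cmFieldDiscrOfJ_eq_neg_seven (h : cmFieldDiscrOfJ W.j = -7)
    (P Q : W.toAffine.Point) (hP : P ≠ 0) (hP2 : 2 • P = 0) (hQ : Q ≠ 0) (hQ2 : 2 • Q = 0) :
    P = Q := by
  rcases j_eq_of_cmFieldDiscrOfJ_eq_neg_seven h with hj | hj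
  · exact twoTorsion_unique_of_j_eq_neg_3375 W hj P Q hP hP2 hQ hQ2
  · exact twoTorsion_unique_of_j_eq_16581375 W hj P Q hP hP2 hQ hQ2

/-- **BCST 2022, Remark D, verbatim: `E(ℚ)[2] ≃ ℤ/2ℤ` for every `E/ℚ` with CM by `ℚ(√−7)`** —
there is EXACTLY ONE rational point `P ≠ O` with `2P = O` (existence: `CMTwoTorsion.lean`;
uniqueness: this file). Elementary; no table. [cite: BurungaleCastellaSkinnerTian2022, Rem. D (p. 327)] -/
theorem existsUnique_twoTorsion_of_cmFieldDiscrOfJ_eq_neg_seven (h : cmFieldDiscrOfJ W.j = -7) :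
    ∃! P : W.toAffine.Point, P ≠ 0 ∧ 2 • P = 0 := by
  obtain ⟨P, hP, hP2⟩ := exists_twoTorsion_of_cmFieldDiscrOfJ_eq_neg_seven W h
  exact ⟨P, ⟨hP, hP2⟩, fun Q hQ ↦
    twoTorsion_unique_of_cmFieldDiscrOfJ_eq_neg_seven W h Q P hQ.1 hQ.2 hP hP2⟩

/-- Hence the FULL `2`-torsion of such a curve is never rational: there are no two distinct
rational points of order `2` (`E(ℚ)[2] ≄ (ℤ/2ℤ)²` — the hypothesis of Smith's theorem quoted in
Remark D is never met on the `ℚ(√−7)` family). [cite: BurungaleCastellaSkinnerTian2022, Rem. D (p. 327)] -/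
theorem not_fullTwoTorsion_of_cmFieldDiscrOfJ_eq_neg_seven (h : cmFieldDiscrOfJ W.j = -7) :
    ¬ ∃ P Q : W.toAffine.Point, P ≠ Q ∧ P ≠ 0 ∧ Q ≠ 0 ∧ 2 • P = 0 ∧ 2 • Q = 0 := by
  rintro ⟨P, Q, hPQ, hP, hQ, hP2, hQ2⟩
  exact hPQ (twoTorsion_unique_of_cmFieldDiscrOfJ_eq_neg_seven W h P Q hP hP2 hQ hQ2)

/-- The same on the scope of BCST Theorem A / Corollary B at `p = 2` (CM, good ordinary at `2`;
Deuring `hDeu`): exactly one rational point of order `2`.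
[cite: BurungaleCastellaSkinnerTian2022, Rem. D (p. 327), Thm. A (p. 326)]
[cite: Lang1987, Ch. 13 §4 Thm. 12] -/
theorem existsUnique_twoTorsion_of_hasCM_of_goodOrd_two
    (hDeu : deuring_not_hasUnitRootAt_of_hasCM_of_not_cmSplit) [W.IsGloballyMinimal]
    (hCM : W.HasCM) [Fact (2 : ℕ).Prime] (hgood : W.HasGoodReductionAtPrime 2)
    (hord : ¬ ((2 : ℕ) : ℤ) ∣ W.frobeniusTrace 2) :
    ∃! P : W.toAffine.Point, P ≠ 0 ∧ 2 • P = 0 :=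
  existsUnique_twoTorsion_of_cmFieldDiscrOfJ_eq_neg_seven W
    (cmFieldDiscrOfJ_eq_of_goodOrd_two hDeu W hCM hgood hord)

end OverRat

end Summit.BirchSwinnertonDyer.Rank1Residual.X12
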